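import Summits.QuantumFields.YangMills.Theorems.UnitScaleTiltProp7OneStepL2BoundsT3
import Summits.QuantumFields.YangMills.Theorems.UnitScaleTiltProp7OneStepDefectT3
import Literature.Barriers.QuantumFields.UnitaryHaarSmallBall
import HarnessLib

/-!
# `UnitScaleTiltProp7SliceBoundOneStepT3` — (I3′) PLAN B, FILE P4-C «SliceBoundOneStep»: THE `ℓ²` SLICE BOUND `hT` OF FILE B′ FROM ONE DISPLAYED ROW — the one-step defect row (E-ROW)
# `Σ_c ‖(linAvg − γ_j)(Y)(c)‖² ≤ K_E·Σ_p ‖curl Y(p)‖²` — by the two scalar recursions of px22's (A,Φ) split; constant `C(L, K_E)∕ℓ`, K-FREE by construction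
(route `UnitScaleTilt`, crux K1 «MinimiserStabilityRegPr» stmt-QuantumFields-19200; route-R E′ (A′)-comb; ★★OWNER RULING №18 (2) «COMB-FLAT-COERCIVITY := FILE B ∘ τ + isometry transfer + (I3′)»;
(I3′) organisation of record = px22 g5 PLAN B `LOCATE-I3-ONESTEP-px22g5.md` ac2baf06 adopted by the (I3′) pen w4 g8 2026-08-29T05:54:26Z (P1 w4 ✓`Prop7GradBlindLocalCurlBound` · P2 px21 ✓`Prop7OneStepDefect` ·
P3 px22 ✓`Prop7DefectTelescope` ∕ `Prop7DefectTelescopeMember.defect_eq_A_add_grad` · **P4 px6**: P4-A ✓`Prop7SliceBoundBookkeeping`, P4-B ✓`Prop7OneStepL2Bounds`, P4-C = this file, P4-D = the E-ROW from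
P1 ∘ P2's support row); def-free, count-neutral).  Cell `ym3-torus` (HUMAN RULING D-0037, YM ladder rung R3 — YM₃ on T³ is a rung, not d = 4, not infinite volume, not a mass gap, not Clay), width
seat `ym3-torus-px6` (gen 6).

THE PRINT.  [Balaban1985BackgroundPropagators] Thm 3.11 p. 416 at the flat member needs (I3′): `Σ_c|δQ̃X(c)|² ≤ C(L)·ℓ⁻¹·Σ_p|curl X(p)|²` for the comb-minus-sym defect `δQ̃ = η(Q^{tw}_k(1)X′ − Q^{twS}_k(1)X)`
([Balaban1985Variational] (44) vs [Balaban1985Averaging] (124)–(127)); FILE B′ ✓`Prop7SliceRowOfSqBound.sliceBound_basePt_of_sqBound` reads it from the `ℓ²` row `hT`.  PLAN B (px22 §2–§6, machine-checked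
identities): `ℓ·δQ̃ = A_k X′ + d_kΦ_k X′` with `A_{j+1} = L•Q(A_j) + e_j(T′_j)`, `Φ_{j+1} = Φ_j∘emb − λ̄(A_j)`, `T′_{j+1} = T(T′_j)` (cornered tube), `e_j := linAvg − γ_j` (P3-B ✓`defect_eq_A_add_grad`).
THIS FILE runs the two SCALAR recursions on the GLOBAL `ℓ²` norms: with `a_j := Σ‖A_j‖²`, `τ_j := Σ‖curl T′_j‖²`, `φ_j := Σ‖Φ_j‖²`, `κ := Σ_p‖curl X(p)‖²`: `τ_{j+1} ≤ L·τ_j` (P4-B (B5) at the cornered tube, d = 3),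
`a_{j+1} ≤ 2L⁻¹a_j + 2K_E τ_j`, `φ_{j+1} ≤ 2φ_j + 2((d+2)L)²a_j` (P4-B (B1)–(B3)) ⇒ by P4-A's DYADIC assembly (`Σ_{j<k}2^{k−1−j}L^j ≤ L^k∕(L−2)`) `a_k, φ_k ≤ C·ℓ·κ`, and `Σ_ĉ‖A_k ĉ + dΦ_k ĉ‖² ≤ 2a_k + 24φ_k`
(P4-B (B4)) — so `hT` holds with `A′ = C(L, K_E)∕ℓ` (`η² = ℓ⁻²` against ONE `ℓ`): K-FREE.  The ONE displayed hypothesis is the E-ROW at every level `j < K − n` (P4-D: P1 ✓`normSq_le_of_gradBlind_local` ∘ P2's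
support row ∘ a box count).

WHAT IS PROVED (sorry-free, no definition): §0 `sum_norm_sq_entry_le_four_mul` ∕ `l2_opNorm_sq_le_sum_norm_sq_entry` (entries vs the `L2Operator` norm on `M₂(ℂ)`); §1 `transl_emb_boxVec_eq_blockSite_add`,
★`cornerTube_eq_smul_bondAvg_translate` (px21's cornered tube = P4-B's `L•Q` of the half-block translate), ★`sum_norm_sq_cornerTube_le` (B1c), ★★`sum_norm_sq_curl_cornerTube_le` (B5c); §2 ★`dyadic_rec_le`
(the scalar recursion `x_{j+1} ≤ 2x_j + 2s_j`, `s_j ≤ C·L^j` ⇒ `x_k ≤ 2C·L^k∕(L−2)`); §3 ★★★`sum_norm_sq_defect_le_of_eRow` (any `Params P` with `d = 3`, `L ≥ 3`; families `T′ A Φ` with P3-B's recursions as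
hypotheses; E-ROW displayed): `Σ_{ĉ : PBond P k}‖A_k ĉ + (Φ_k ĉ₊ − Φ_k ĉ₋)‖² ≤ (8K_E∕(L−2) + 9600L²K_E∕(L−2)²)·L^k·Σ_p‖curl 1 x p‖²`.  THE MEMBER KNIT (FILE B′'s `hT` TOKEN FOR
TOKEN with `A′ := 4·Cdef∕ℓ` over px22's ✓`defect_eq_A_add_grad`, hence px13's (hv) and the A6ᶜ certificate modulo the E-ROW) is the sibling file `UnitScaleTiltProp7SliceBoundOneStepMemberT3`.
HONEST FRAMING.  Bookkeeping + Cauchy–Schwarz over P4-A∕P4-B∕P3-B; the E-ROW (one-step defect bounded by the local curl energy, [Balaban1985Averaging] (124)–(127) ∕ [Balaban1984PropagatorsI] (1.9)) is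
DISPLAYED, not proved here (P4-D); nothing of (I3′) beyond this reduction, of COMB-FLAT-COERCIVITY, A6ᶜ, N06 or the crux K1 is proved or claimed.  Rung R3, not Clay; YM gap NOT proved.
`--supports stmt-QuantumFields-19200 --as helper`.
References: T. Bałaban, CMP 99 (1985) 389–434 [Balaban1985BackgroundPropagators] ((3.14) p.393, Thm 3.11 p.416); CMP 98 (1985) 17–51 [Balaban1985Averaging] ((62) p.28, (124)–(127) pp.36–37, (160) p.42);
CMP 95 (1984) 17–40 [Balaban1984PropagatorsI] ((1.9)–(1.11) p.19, (1.18) p.20); CMP 102 (1985) 277–309 [Balaban1985Variational] ((44)–(47) p.285).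
-/

noncomputable section
open scoped BigOperators Matrix.Norms.L2Operator

namespace Summit.QuantumFields.YangMills.Theorems.Prop7SliceBoundOneStep

open Literature.MathematicalPhysics.QuantumFieldTheory.Balaban1983to89
open B7Prop1Explicit (boxVec treeWord)
open B10Eq27TorusAxialLog (transl transl_apply)
open T4Continuum BlockAveraging LatticeFieldCalculus
open BlockAveragingEMLLinearised (walkSum linAvg combMean)
open Summit.QuantumFields.YangMills.Theorems.Prop7SliceBoundBookkeeping (dyadic_level_sum_le norm_sq_sum_le_card_mul)
open Summit.QuantumFields.YangMills.Theorems.Prop7OneStepL2Bounds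
  (sum_norm_sq_smul_bondAvg_le sum_norm_sq_combMean_le sum_norm_sq_comp_emb_le sum_norm_sq_coarseGrad_le sum_norm_sq_curl_smul_bondAvg_le sum_norm_sq_curl_translate curl_smul)
open Literature.Barriers.QuantumFields (norm_entry_le_l2_opNorm)

variable {P : Params} {j : ℕ}

/-! ## §0 Entries versus the `L2Operator` norm on `2 × 2` complex matrices -/

section MatrixNorm

/-- `Σ_{i i′} ‖A i i′‖² ≤ 4‖A‖²` for `A : M₂(ℂ)` in the `L2Operator` norm (each entry is bounded by the operator norm, lit ✓`norm_entry_le_l2_opNorm`). [folklore] -/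
theorem sum_norm_sq_entry_le_four_mul (A : Matrix (Fin 2) (Fin 2) ℂ) : ∑ i, ∑ i', ‖A i i'‖ ^ 2 ≤ 4 * ‖A‖ ^ 2 := by
  have h : ∀ i i', ‖A i i'‖ ^ 2 ≤ ‖A‖ ^ 2 := fun i i' => pow_le_pow_left₀ (norm_nonneg _) (norm_entry_le_l2_opNorm A i i') 2
  calc ∑ i, ∑ i', ‖A i i'‖ ^ 2 ≤ ∑ _i : Fin 2, ∑ _i' : Fin 2, ‖A‖ ^ 2 := Finset.sum_le_sum fun i _ => Finset.sum_le_sum fun i' _ => h i i'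
    _ = 4 * ‖A‖ ^ 2 := by simp only [Finset.sum_const, Finset.card_univ, Fintype.card_fin, nsmul_eq_mul]; ring

/-- `‖A‖² ≤ Σ_{i j} ‖A i j‖²` for the `L2Operator` norm (operator norm ≤ Frobenius norm: Cauchy–Schwarz row by row). [folklore] -/
theorem l2_opNorm_sq_le_sum_norm_sq_entry {m k : Type*} [Fintype m] [Fintype k] [DecidableEq k] (A : Matrix m k ℂ) :
    ‖A‖ ^ 2 ≤ ∑ i, ∑ j, ‖A i j‖ ^ 2 := by
  set Fr : ℝ := ∑ i, ∑ j, ‖A i j‖ ^ 2 with hFr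
  have hFr0 : 0 ≤ Fr := Finset.sum_nonneg fun i _ => Finset.sum_nonneg fun j _ => by positivity
  -- the operator norm is at most `√Fr`
  have hop : ‖A‖ ≤ Real.sqrt Fr := by
    rw [Matrix.l2_opNorm_def]
    refine ContinuousLinearMap.opNorm_le_bound _ (Real.sqrt_nonneg _) fun x => ?_
    -- `‖A x‖² = Σ_i ‖Σ_j A i j x j‖² ≤ Σ_i (Σ_j ‖A i j‖²)(Σ_j ‖x j‖²) = Fr·‖x‖²`
    have hAx : ((Matrix.toEuclideanLin (𝕜 := ℂ) (m := m) (n := k)).trans LinearMap.toContinuousLinearMap A) x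
        = (EuclideanSpace.equiv m ℂ).symm (A.mulVec x.ofLp) := rfl
    rw [hAx]
    have hx2 : ‖x‖ ^ 2 = ∑ j, ‖x.ofLp j‖ ^ 2 := by
      rw [EuclideanSpace.norm_eq, Real.sq_sqrt (Finset.sum_nonneg fun j _ => by positivity)]
    have hrow : ∀ i, ‖(A.mulVec x.ofLp) i‖ ^ 2 ≤ (∑ j, ‖A i j‖ ^ 2) * ∑ j, ‖x.ofLp j‖ ^ 2 := by
      intro i
      have h1 : ‖(A.mulVec x.ofLp) i‖ ≤ ∑ j, ‖A i j‖ * ‖x.ofLp j‖ := by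
        rw [Matrix.mulVec, dotProduct]
        exact (norm_sum_le _ _).trans (Finset.sum_le_sum fun j _ => (norm_mul_le _ _))
      have h2 := Finset.sum_mul_sq_le_sq_mul_sq Finset.univ (fun j => ‖A i j‖) (fun j => ‖x.ofLp j‖)
      calc ‖(A.mulVec x.ofLp) i‖ ^ 2 ≤ (∑ j, ‖A i j‖ * ‖x.ofLp j‖) ^ 2 := pow_le_pow_left₀ (norm_nonneg _) h1 2
        _ ≤ (∑ j, ‖A i j‖ ^ 2) * ∑ j, ‖x.ofLp j‖ ^ 2 := h2
    have hnorm : ‖(EuclideanSpace.equiv m ℂ).symm (A.mulVec x.ofLp)‖ ^ 2 ≤ Fr * ‖x‖ ^ 2 := by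
      rw [EuclideanSpace.norm_eq, Real.sq_sqrt (Finset.sum_nonneg fun i _ => by positivity), hx2, hFr, Finset.sum_mul]
      exact Finset.sum_le_sum fun i _ => hrow i
    have h3 : ‖(EuclideanSpace.equiv m ℂ).symm (A.mulVec x.ofLp)‖ ^ 2 ≤ (Real.sqrt Fr * ‖x‖) ^ 2 := by
      rw [mul_pow, Real.sq_sqrt hFr0]; exact hnorm
    exact (pow_le_pow_iff_left₀ (norm_nonneg _) (by positivity) two_ne_zero).1 h3
  calc ‖A‖ ^ 2 ≤ (Real.sqrt Fr) ^ 2 := pow_le_pow_left₀ (norm_nonneg _) hop 2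
    _ = Fr := Real.sq_sqrt hFr0

end MatrixNorm

/-! ## §1 px21's CORNERED tube is P4-B's `L•Q` of the half-block translate: (B1c), (B5c) -/

section Cornered

variable {V : Type*} [NormedAddCommGroup V] [NormedSpace ℝ V]

omit [NormedSpace ℝ V] in
/-- The cornered box point `emb y + r` is the centred block point `blockSite y r` translated by the half-block vector `h·1`, `h = (L−1)∕2` (labels `L·y + h + r = (L·y + r) + h`; no range
hypothesis: an identity in `ZMod`). [cite: Balaban1987RG1, (0.3) p.252] -/
theorem transl_emb_boxVec_eq_blockSite_add (y : Site P (j + 1)) (r : Fin P.d → Fin P.L) :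
    transl (emb y) (boxVec P.L r) = Site.blockSite y r + (transl (0 : Site P j) (fun _ => ((((P.L - 1) / 2 : ℕ)) : ℤ))) := by
  funext μ
  rw [Site.add_apply, transl_apply, transl_apply, show (0 : Site P j) μ = 0 from rfl, zero_add, Int.cast_natCast]
  simp only [emb, Site.blockSite, boxVec, Int.cast_natCast]
  push_cast
  ring

/-- ★ **px21's CORNERED TUBE IS P4-B's `L•Q` OF THE HALF-BLOCK TRANSLATE**: `L^{−d}·Σ_r segSum Y (emb c₋ + r) μ L = L•(Q (Y ∘ τ_{h·1}))(c)` (✓`Prop7DefectChainForms.segSum_translate`).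
[cite: Balaban1984PropagatorsI, (1.11) p.19; Balaban1987RG1, (0.3) p.252] -/
theorem cornerTube_eq_smul_bondAvg_translate (Y : VecField P j V) (c : PBond P (j + 1)) :
    (((P.L : ℝ) ^ P.d)⁻¹) • ∑ r : Fin P.d → Fin P.L, segSum Y (transl (emb c.src) (boxVec P.L r)) c.dir P.L
      = (P.L : ℝ) • bondAvg (fun b => Y (b.translate (transl (0 : Site P j) (fun _ => ((((P.L - 1) / 2 : ℕ)) : ℤ))))) c := by
  have hL : (P.L : ℝ) ≠ 0 := by exact_mod_cast P.L_pos.ne'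
  unfold bondAvg
  rw [smul_smul, show (P.L : ℝ) * ((P.L : ℝ) ^ (P.d + 1))⁻¹ = ((P.L : ℝ) ^ P.d)⁻¹ by rw [pow_succ]; field_simp]
  congr 1
  refine Finset.sum_congr rfl fun r _ => ?_
  rw [Prop7DefectChainForms.segSum_translate, transl_emb_boxVec_eq_blockSite_add]

/-- ★ (B1c) **THE CORNERED TUBE STEP CONTRACTS `ℓ²` BY `L^{2−d}`**: `Σ_c ‖T Y(c)‖² ≤ (L²∕L^d)·Σ_b ‖Y b‖²` (P4-B (B1) for the translate, and translation is a bijection of the bonds).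
[cite: Balaban1984PropagatorsI, (1.11) p.19, (1.18) p.20] -/
theorem sum_norm_sq_cornerTube_le (hj : j + 1 ≤ P.m + P.K) (Y : VecField P j V) :
    ∑ c : PBond P (j + 1), ‖(((P.L : ℝ) ^ P.d)⁻¹) • ∑ r : Fin P.d → Fin P.L, segSum Y (transl (emb c.src) (boxVec P.L r)) c.dir P.L‖ ^ 2
      ≤ ((P.L : ℝ) ^ 2 / (P.L : ℝ) ^ P.d) * ∑ b : PBond P j, ‖Y b‖ ^ 2 := by
  simp only [cornerTube_eq_smul_bondAvg_translate]
  refine (sum_norm_sq_smul_bondAvg_le hj _).trans (le_of_eq ?_)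
  congr 1
  exact (PBond.translateEquiv (transl (0 : Site P j) (fun _ => ((((P.L - 1) / 2 : ℕ)) : ℤ)))).sum_comp (fun b => ‖Y b‖ ^ 2)

/-- ★★ (B5c) **THE CURL THROUGH ONE CORNERED TUBE STEP COSTS `L^{4−d}`**: `Σ_{p′} ‖curl (T Y)(p′)‖² ≤ (L⁴∕L^d)·Σ_p ‖curl Y(p)‖²` (P4-B (B5) for the translate ∘ (B6)).  Iterated along P3-B's `hTs` it
bounds the curl energy of the `j`-fold cornered tube `T′_j` by `(L⁴∕L^d)^j·Σ‖curl X′‖²`. [cite: Balaban1984PropagatorsI, (1.9) p.19, (1.18) p.20; Balaban1985Averaging, (9) p.19] -/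
theorem sum_norm_sq_curl_cornerTube_le (hj : j + 1 ≤ P.m + P.K) (Y : VecField P j V) (T : VecField P (j + 1) V)
    (hT : ∀ c : PBond P (j + 1), T c = (((P.L : ℝ) ^ P.d)⁻¹) • ∑ r : Fin P.d → Fin P.L, segSum Y (transl (emb c.src) (boxVec P.L r)) c.dir P.L) :
    ∑ p' : Plaq P (j + 1), ‖curl 1 T p'‖ ^ 2 ≤ ((P.L : ℝ) ^ 4 / (P.L : ℝ) ^ P.d) * ∑ p : Plaq P j, ‖curl 1 Y p‖ ^ 2 := by
  have hfun : T = (P.L : ℝ) • bondAvg (fun b => Y (b.translate (transl (0 : Site P j) (fun _ => ((((P.L - 1) / 2 : ℕ)) : ℤ))))) := by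
    funext c; rw [hT c, cornerTube_eq_smul_bondAvg_translate]; rfl
  rw [hfun]
  refine (sum_norm_sq_curl_smul_bondAvg_le hj _).trans (le_of_eq ?_)
  rw [sum_norm_sq_curl_translate]

end Cornered

/-! ## §2 The scalar dyadic recursion -/

section Scalar

/-- ★ **THE SCALAR RECURSION `x_{j+1} ≤ 2x_j + 2s_j` WITH GEOMETRIC SOURCE**: if `x 0 = 0`, `x (j+1) ≤ 2·x j + 2·s j` and `s j ≤ C·L^j` for `j < k` (`L ≥ 3`), then `x k ≤ 4C·L^k∕(L−2)` — the source
growth `L^j` beats the homogeneous growth `2^j` (P4-A ✓`dyadic_level_sum_le`); this is the shape of both the `A`- and the `Φ`-recursion of px22's (A,Φ) split.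
[cite: Balaban1985Averaging, (124)–(127) p.36] -/
theorem dyadic_rec_le (x s : ℕ → ℝ) {C L : ℝ} (hC : 0 ≤ C) (hL : 3 ≤ L) (hx0 : x 0 ≤ 0) (k : ℕ)
    (hxs : ∀ j, j < k → x (j + 1) ≤ 2 * x j + 2 * s j) (hs : ∀ j, j < k → s j ≤ C * L ^ j) :
    x k ≤ 4 * C * L ^ k / (L - 2) := by
  -- unrolled: `x k' ≤ 2^{k'}·Σ_{j<k'} (1/2)^j·(C·L^j)` for every `k' ≤ k`
  have hrec : ∀ k', k' ≤ k → x k' ≤ (2:ℝ) ^ k' * ∑ j ∈ Finset.range k', (1 / 2 : ℝ) ^ j * (C * L ^ j) := by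
    intro k'
    induction k' with
    | zero => intro _; simpa using hx0
    | succ k' ih =>
      intro hk'
      have ihk := ih (Nat.le_of_succ_le hk')
      have hlt : k' < k := Nat.lt_of_succ_le hk'
      rw [Finset.sum_range_succ, pow_succ]
      have hhalf : (2:ℝ) ^ k' * 2 * ((1 / 2 : ℝ) ^ k' * (C * L ^ k')) = 2 * (C * L ^ k') := by
        rw [one_div, inv_pow]; field_simp
      calc x (k' + 1) ≤ 2 * x k' + 2 * s k' := hxs k' hlt
        _ ≤ 2 * ((2:ℝ) ^ k' * ∑ j ∈ Finset.range k', (1 / 2 : ℝ) ^ j * (C * L ^ j)) + 2 * (C * L ^ k') := by linarith [hs k' hlt]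
        _ = (2:ℝ) ^ k' * 2 * (∑ j ∈ Finset.range k', (1 / 2 : ℝ) ^ j * (C * L ^ j) + (1 / 2 : ℝ) ^ k' * (C * L ^ k')) := by
            rw [mul_add, hhalf]; ring
  have h1 := hrec k le_rfl
  rcases Nat.eq_zero_or_pos k with hk | hk
  · subst hk
    simp only [pow_zero, Finset.range_zero, Finset.sum_empty, mul_zero] at h1
    have : 0 ≤ 4 * C * L ^ 0 / (L - 2) := by rw [pow_zero]; exact div_nonneg (by linarith) (by linarith)
    linarith
  have hd := dyadic_level_sum_le hL k
  have e : (2:ℝ) ^ k * ∑ j ∈ Finset.range k, (1 / 2 : ℝ) ^ j * (C * L ^ j) = 2 * C * ∑ j ∈ Finset.range k, (2:ℝ) ^ (k - 1) * (1 / 2) ^ j * L ^ j := by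
    have hk1 : (2:ℝ) ^ k = 2 * 2 ^ (k - 1) := by rw [← pow_succ']; congr 1; omega
    rw [hk1, Finset.mul_sum, Finset.mul_sum]
    exact Finset.sum_congr rfl fun j _ => by ring
  rw [e] at h1
  calc x k ≤ 2 * C * ∑ j ∈ Finset.range k, (2:ℝ) ^ (k - 1) * (1 / 2) ^ j * L ^ j := h1
    _ ≤ 2 * C * (L ^ k / (L - 2)) := mul_le_mul_of_nonneg_left hd (by linarith)
    _ ≤ 4 * C * L ^ k / (L - 2) := by
        have hLk : 0 ≤ L ^ k / (L - 2) := div_nonneg (pow_nonneg (by linarith) k) (by linarith)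
        rw [mul_div_assoc]; nlinarith

end Scalar

/-! ## §3 ★★★ The two scalar recursions: the defect energy from the E-ROW -/

section Recursion

variable (P)

set_option maxHeartbeats 400000 in
/-- ★★★ **THE DEFECT ENERGY FROM THE ONE-STEP DEFECT ROW (E-ROW).**  On any `d = 3` torus tower with `L ≥ 3`, for families `T′ A Φ` satisfying P3-B's recursions (`T′` the cornered tube
product, `A_{j+1} = L•Q(A_j) + e_j(T′_j)`, `Φ_{j+1} = Φ_j∘emb − λ̄(A_j)`, `A_0 = Φ_0 = 0`) and every height `k` in the standing range: if the one-step defect `e_j = linAvg − γ_j` obeys the E-ROW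
`Σ_c ‖e_j Y(c)‖² ≤ K_E·Σ_p ‖curl Y(p)‖²` at every level `j < k`, then `Σ_{ĉ : PBond P k} ‖A_k ĉ + (Φ_k ĉ₊ − Φ_k ĉ₋)‖² ≤ (8K_E∕(L−2) + 9600·L²·K_E∕(L−2)²)·L^k·Σ_p ‖curl 1 x p‖²` — ORDER `ℓ = L^k`,
K-FREE.  Recursions: `τ_{j+1} ≤ L·τ_j` (B5c), `a_{j+1} ≤ 2a_j + 2K_Eτ_j` ((B1c)+E-ROW), `φ_{j+1} ≤ 2φ_j + 2(5L)²a_j` ((B3)+(B2)), closed by `dyadic_rec_le`; last step (B4).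
[cite: Balaban1985Averaging, (124)–(127) pp.36–37, (160) p.42; Balaban1984PropagatorsI, (1.9) p.19, (1.18) p.20; Balaban1985BackgroundPropagators, Thm 3.11 p.416] -/
theorem sum_norm_sq_defect_le_of_eRow (hd : P.d = 3) (hL3 : 3 ≤ P.L) {k : ℕ} (hk : k ≤ P.m + P.K)
    (T' : (j : ℕ) → (PBond P 0 → Matrix (Fin 2) (Fin 2) ℂ) → PBond P j → Matrix (Fin 2) (Fin 2) ℂ)
    (hT0 : ∀ x, T' 0 x = x)
    (hTs : ∀ (j : ℕ) (x : PBond P 0 → Matrix (Fin 2) (Fin 2) ℂ) (c : PBond P (j + 1)),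
      T' (j + 1) x c = ((((P.L : ℝ)) ^ P.d)⁻¹) • ∑ r : Fin P.d → Fin P.L, segSum (T' j x) (transl (emb c.src) (boxVec P.L r)) c.dir P.L)
    (A : (j : ℕ) → (PBond P 0 → Matrix (Fin 2) (Fin 2) ℂ) → PBond P j → Matrix (Fin 2) (Fin 2) ℂ)
    (hA0 : ∀ x b, A 0 x b = 0)
    (hAs : ∀ (j : ℕ) (x : PBond P 0 → Matrix (Fin 2) (Fin 2) ℂ) (c : PBond P (j + 1)),
      A (j + 1) x c = ((P.L : ℕ) : ℂ) • bondAvg (A j x) c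
        + (linAvg (T' j x) c
          - ( (((P.L : ℝ)) ^ P.d)⁻¹ • ∑ r : Fin P.d → Fin P.L, segSum (T' j x) (transl (emb c.src) (boxVec P.L r)) c.dir P.L
              - ( (((P.L : ℝ)) ^ P.d)⁻¹ • ∑ r : Fin P.d → Fin P.L, walkSum (T' j x) (walk (emb c.tgt) (treeWord (boxVec P.L r)))
                  - (((P.L : ℝ)) ^ P.d)⁻¹ • ∑ r : Fin P.d → Fin P.L, walkSum (T' j x) (walk (emb c.src) (treeWord (boxVec P.L r))) ) )))
    (Φ : (j : ℕ) → (PBond P 0 → Matrix (Fin 2) (Fin 2) ℂ) → Site P j → Matrix (Fin 2) (Fin 2) ℂ)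
    (hΦ0 : ∀ x y, Φ 0 x y = 0)
    (hΦs : ∀ (j : ℕ) (x : PBond P 0 → Matrix (Fin 2) (Fin 2) ℂ) (y : Site P (j + 1)), Φ (j + 1) x y = Φ j x (emb y) - combMean (A j x) y)
    {K_E : ℝ} (hKE : 0 ≤ K_E)
    (hE : ∀ (j : ℕ), j < k → ∀ (Y : PBond P j → Matrix (Fin 2) (Fin 2) ℂ) (e : PBond P (j + 1) → Matrix (Fin 2) (Fin 2) ℂ),
      (∀ c : PBond P (j + 1), e c = linAvg Y c - ( (((P.L : ℝ)) ^ P.d)⁻¹ • ∑ r : Fin P.d → Fin P.L, segSum (Y) (transl (emb c.src) (boxVec P.L r)) c.dir P.L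
              - ( (((P.L : ℝ)) ^ P.d)⁻¹ • ∑ r : Fin P.d → Fin P.L, walkSum (Y) (walk (emb c.tgt) (treeWord (boxVec P.L r)))
                  - (((P.L : ℝ)) ^ P.d)⁻¹ • ∑ r : Fin P.d → Fin P.L, walkSum (Y) (walk (emb c.src) (treeWord (boxVec P.L r))) ) )) →
      ∑ c : PBond P (j + 1), ‖e c‖ ^ 2 ≤ K_E * ∑ p : Plaq P j, ‖curl 1 Y p‖ ^ 2)
    (x : PBond P 0 → Matrix (Fin 2) (Fin 2) ℂ) :
    ∑ c : PBond P k, ‖A k x c + (Φ k x c.tgt - Φ k x c.src)‖ ^ 2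
      ≤ (8 * K_E / ((P.L : ℝ) - 2) + 9600 * (P.L : ℝ) ^ 2 * K_E / ((P.L : ℝ) - 2) ^ 2) * (P.L : ℝ) ^ k * ∑ p : Plaq P 0, ‖curl 1 x p‖ ^ 2 := by
  -- scalars
  set L : ℝ := (P.L : ℝ) with hLdef
  have hL : 3 ≤ L := by rw [hLdef]; exact_mod_cast hL3
  have hL0 : 0 < L := by linarith
  set κ : ℝ := ∑ p : Plaq P 0, ‖curl 1 x p‖ ^ 2 with hκ
  have hκ0 : 0 ≤ κ := Finset.sum_nonneg fun p _ => by positivity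
  -- the three level quantities
  let τ : ℕ → ℝ := fun j => ∑ p : Plaq P j, ‖curl 1 (T' j x) p‖ ^ 2
  let a : ℕ → ℝ := fun j => ∑ c : PBond P j, ‖A j x c‖ ^ 2
  let φ : ℕ → ℝ := fun j => ∑ y : Site P j, ‖Φ j x y‖ ^ 2
  have hrange : ∀ j, j < k → j + 1 ≤ P.m + P.K := fun j hj => by omega
  -- (τ) the curl energy of the cornered tube product grows by `L` per level
  have hτs : ∀ j, j < k → τ (j + 1) ≤ L * τ j := by
    intro j hj
    have h := sum_norm_sq_curl_cornerTube_le (hrange j hj) (T' j x) (T' (j + 1) x) (hTs j x)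
    have hc : ((P.L : ℝ)) ^ 4 / ((P.L : ℝ)) ^ P.d = L := by rw [hd, hLdef]; field_simp
    rw [hc] at h
    exact h
  have hτ : ∀ j, j ≤ k → τ j ≤ L ^ j * κ := by
    intro j
    induction j with
    | zero => intro _; simp [τ, hT0, hκ]
    | succ j ih =>
      intro hj
      have hj' : j < k := Nat.lt_of_succ_le hj
      calc τ (j + 1) ≤ L * τ j := hτs j hj'
        _ ≤ L * (L ^ j * κ) := mul_le_mul_of_nonneg_left (ih hj'.le) hL0.le
        _ = L ^ (j + 1) * κ := by ring
  -- (a) `a_{j+1} ≤ 2a_j + 2K_Eτ_j`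
  have has : ∀ j, j < k → a (j + 1) ≤ 2 * a j + 2 * (K_E * τ j) := by
    intro j hj
    -- the one-step defect field of level `j`
    let eJ : PBond P (j + 1) → Matrix (Fin 2) (Fin 2) ℂ := fun c => linAvg (T' j x) c - ( (((P.L : ℝ)) ^ P.d)⁻¹ • ∑ r : Fin P.d → Fin P.L, segSum (T' j x) (transl (emb c.src) (boxVec P.L r)) c.dir P.L
              - ( (((P.L : ℝ)) ^ P.d)⁻¹ • ∑ r : Fin P.d → Fin P.L, walkSum (T' j x) (walk (emb c.tgt) (treeWord (boxVec P.L r)))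
                  - (((P.L : ℝ)) ^ P.d)⁻¹ • ∑ r : Fin P.d → Fin P.L, walkSum (T' j x) (walk (emb c.src) (treeWord (boxVec P.L r))) ) )
    have heJ : ∀ c : PBond P (j + 1), eJ c = linAvg (T' j x) c - ( (((P.L : ℝ)) ^ P.d)⁻¹ • ∑ r : Fin P.d → Fin P.L, segSum (T' j x) (transl (emb c.src) (boxVec P.L r)) c.dir P.L
              - ( (((P.L : ℝ)) ^ P.d)⁻¹ • ∑ r : Fin P.d → Fin P.L, walkSum (T' j x) (walk (emb c.tgt) (treeWord (boxVec P.L r)))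
                  - (((P.L : ℝ)) ^ P.d)⁻¹ • ∑ r : Fin P.d → Fin P.L, walkSum (T' j x) (walk (emb c.src) (treeWord (boxVec P.L r))) ) ) := fun c => rfl
    have hsmul : ∀ c : PBond P (j + 1), ((P.L : ℕ) : ℂ) • bondAvg (A j x) c = (P.L : ℝ) • bondAvg (A j x) c := fun c => by
      rw [Nat.cast_smul_eq_nsmul ℂ, Nat.cast_smul_eq_nsmul ℝ]
    have hAc : ∀ c : PBond P (j + 1), A (j + 1) x c = (P.L : ℝ) • bondAvg (A j x) c + eJ c := fun c => by
      rw [← hsmul c]; exact hAs j x c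
    have h1 : ∀ c : PBond P (j + 1), ‖A (j + 1) x c‖ ^ 2 ≤ 2 * ‖(P.L : ℝ) • bondAvg (A j x) c‖ ^ 2 + 2 * ‖eJ c‖ ^ 2 := by
      intro c
      rw [hAc c]
      have h := pow_le_pow_left₀ (norm_nonneg _) (norm_add_le ((P.L : ℝ) • bondAvg (A j x) c) (eJ c)) 2
      nlinarith [sq_nonneg (‖(P.L : ℝ) • bondAvg (A j x) c‖ - ‖eJ c‖)]
    have h2 := sum_norm_sq_smul_bondAvg_le (hrange j hj) (A j x)
    have hc : ((P.L : ℝ)) ^ 2 / ((P.L : ℝ)) ^ P.d ≤ 1 := by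
      rw [hd, div_le_one (by positivity)]
      exact pow_le_pow_right₀ (by linarith) (by norm_num)
    have h2' : ∑ c : PBond P (j + 1), ‖(P.L : ℝ) • bondAvg (A j x) c‖ ^ 2 ≤ a j :=
      h2.trans ((mul_le_of_le_one_left (Finset.sum_nonneg fun b _ => by positivity) hc))
    have h3 := hE j hj (T' j x) eJ heJ
    calc a (j + 1) ≤ ∑ c : PBond P (j + 1), (2 * ‖(P.L : ℝ) • bondAvg (A j x) c‖ ^ 2 + 2 * ‖eJ c‖ ^ 2) := Finset.sum_le_sum fun c _ => h1 c
      _ = 2 * ∑ c : PBond P (j + 1), ‖(P.L : ℝ) • bondAvg (A j x) c‖ ^ 2 + 2 * ∑ c : PBond P (j + 1), ‖eJ c‖ ^ 2 := by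
          rw [Finset.sum_add_distrib, Finset.mul_sum, Finset.mul_sum]
      _ ≤ 2 * a j + 2 * (K_E * τ j) := by linarith
  have ha : ∀ j, j ≤ k → a j ≤ 4 * (K_E * κ) * L ^ j / (L - 2) := by
    intro j hj
    refine dyadic_rec_le a (fun i => K_E * τ i) (by positivity) hL (by simp [a, hA0]) j (fun i hi => has i (by omega)) ?_
    intro i hi
    calc K_E * τ i ≤ K_E * (L ^ i * κ) := mul_le_mul_of_nonneg_left (hτ i (by omega)) hKE
      _ = K_E * κ * L ^ i := by ring
  -- (φ) `φ_{j+1} ≤ 2φ_j + 2(5L)²a_j`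
  have hφs : ∀ j, j < k → φ (j + 1) ≤ 2 * φ j + 2 * (((((P.d + 2) * P.L : ℕ) : ℝ)) ^ 2 * a j) := by
    intro j hj
    have h1 : ∀ y : Site P (j + 1), ‖Φ (j + 1) x y‖ ^ 2 ≤ 2 * ‖Φ j x (emb y)‖ ^ 2 + 2 * ‖combMean (A j x) y‖ ^ 2 := by
      intro y
      rw [hΦs j x y]
      have h := pow_le_pow_left₀ (norm_nonneg _) (norm_sub_le (Φ j x (emb y)) (combMean (A j x) y)) 2
      nlinarith [sq_nonneg (‖Φ j x (emb y)‖ - ‖combMean (A j x) y‖)]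
    have h2 := sum_norm_sq_comp_emb_le (hrange j hj) (Φ j x)
    have h3 := sum_norm_sq_combMean_le (hrange j hj) (A j x)
    calc φ (j + 1) ≤ ∑ y : Site P (j + 1), (2 * ‖Φ j x (emb y)‖ ^ 2 + 2 * ‖combMean (A j x) y‖ ^ 2) := Finset.sum_le_sum fun y _ => h1 y
      _ = 2 * ∑ y : Site P (j + 1), ‖Φ j x (emb y)‖ ^ 2 + 2 * ∑ y : Site P (j + 1), ‖combMean (A j x) y‖ ^ 2 := by
          rw [Finset.sum_add_distrib, Finset.mul_sum, Finset.mul_sum]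
      _ ≤ 2 * φ j + 2 * (((((P.d + 2) * P.L : ℕ) : ℝ)) ^ 2 * a j) := by linarith
  have hφ : φ k ≤ 4 * (((((P.d + 2) * P.L : ℕ) : ℝ)) ^ 2 * (4 * (K_E * κ) / (L - 2))) * L ^ k / (L - 2) := by
    have hC0 : 0 ≤ ((((P.d + 2) * P.L : ℕ) : ℝ)) ^ 2 * (4 * (K_E * κ) / (L - 2)) := by
      have : (0:ℝ) < L - 2 := by linarith
      positivity
    refine dyadic_rec_le φ (fun i => ((((P.d + 2) * P.L : ℕ) : ℝ)) ^ 2 * a i) hC0 hL (by simp [φ, hΦ0]) k hφs ?_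
    intro i hi
    have := ha i hi.le
    calc ((((P.d + 2) * P.L : ℕ) : ℝ)) ^ 2 * a i ≤ ((((P.d + 2) * P.L : ℕ) : ℝ)) ^ 2 * (4 * (K_E * κ) * L ^ i / (L - 2)) :=
          mul_le_mul_of_nonneg_left this (by positivity)
      _ = ((((P.d + 2) * P.L : ℕ) : ℝ)) ^ 2 * (4 * (K_E * κ) / (L - 2)) * L ^ i := by ring
  -- the last step: `Σ‖A_k + dΦ_k‖² ≤ 2a_k + 2·4d·φ_k`
  have hfin : ∑ c : PBond P k, ‖A k x c + (Φ k x c.tgt - Φ k x c.src)‖ ^ 2 ≤ 2 * a k + 2 * (4 * (P.d : ℝ) * φ k) := by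
    have h1 : ∀ c : PBond P k, ‖A k x c + (Φ k x c.tgt - Φ k x c.src)‖ ^ 2 ≤ 2 * ‖A k x c‖ ^ 2 + 2 * ‖Φ k x c.tgt - Φ k x c.src‖ ^ 2 := by
      intro c
      have h := pow_le_pow_left₀ (norm_nonneg _) (norm_add_le (A k x c) (Φ k x c.tgt - Φ k x c.src)) 2
      nlinarith [sq_nonneg (‖A k x c‖ - ‖Φ k x c.tgt - Φ k x c.src‖)]
    have h2 := sum_norm_sq_coarseGrad_le (fun y : Site P k => Φ k x y)
    calc ∑ c : PBond P k, ‖A k x c + (Φ k x c.tgt - Φ k x c.src)‖ ^ 2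
        ≤ ∑ c : PBond P k, (2 * ‖A k x c‖ ^ 2 + 2 * ‖Φ k x c.tgt - Φ k x c.src‖ ^ 2) := Finset.sum_le_sum fun c _ => h1 c
      _ = 2 * a k + 2 * ∑ c : PBond P k, ‖Φ k x c.tgt - Φ k x c.src‖ ^ 2 := by rw [Finset.sum_add_distrib, Finset.mul_sum, Finset.mul_sum]
      _ ≤ 2 * a k + 2 * (4 * (P.d : ℝ) * φ k) := by linarith
  -- numbers (`d = 3`)
  have hd' : (P.d : ℝ) = 3 := by exact_mod_cast hd
  have h52 : ((((P.d + 2) * P.L : ℕ) : ℝ)) = 5 * L := by push_cast; rw [hd', hLdef]; ring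
  have hak := ha k le_rfl
  rw [h52] at hφ
  rw [hd'] at hfin
  have hL2 : 0 < L - 2 := by linarith
  have hLk : 0 ≤ L ^ k := pow_nonneg hL0.le k
  have e1 : 2 * (4 * (K_E * κ) * L ^ k / (L - 2)) + 2 * (4 * (3:ℝ) * (4 * ((5 * L) ^ 2 * (4 * (K_E * κ) / (L - 2))) * L ^ k / (L - 2)))
      = (8 * K_E / (L - 2) + 9600 * L ^ 2 * K_E / (L - 2) ^ 2) * L ^ k * κ := by
    field_simp; ring
  calc ∑ c : PBond P k, ‖A k x c + (Φ k x c.tgt - Φ k x c.src)‖ ^ 2 ≤ 2 * a k + 2 * (4 * (3:ℝ) * φ k) := hfin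
    _ ≤ 2 * (4 * (K_E * κ) * L ^ k / (L - 2)) + 2 * (4 * (3:ℝ) * (4 * ((5 * L) ^ 2 * (4 * (K_E * κ) / (L - 2))) * L ^ k / (L - 2))) := by
        nlinarith [hak, hφ]
    _ = (8 * K_E / (L - 2) + 9600 * L ^ 2 * K_E / (L - 2) ^ 2) * L ^ k * κ := e1

end Recursion

end Summit.QuantumFields.YangMills.Theorems.Prop7SliceBoundOneStep

end
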